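import Literature.Analysis.FunctionSpaces.TorusVectorParseval
import Literature.Analysis.FunctionSpaces.TorusInverseLaplacianL2
import Literature.Analysis.FunctionSpaces.TorusCalculus
import Mathlib.MeasureTheory.Integral.MeanInequalities
import HarnessLib

/-!
# The `Ḣ⁻¹ – Ḣ¹` duality bound for pairings of real vector fields on the torus

Trunk: Sobolev (`Literature/Analysis/FunctionSpaces`). Support lemma for the perturbation step of
M. P. Coiculescu, S. Palasek, *Non-uniqueness of smooth solutions of the Navier–Stokes equations
from critical data*, Invent. Math. 244 (2025) = arXiv:2503.14699, §5 (both solutions attain the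
same datum weakly): once the correction `w(t)` tends to `0` in `Ḣ⁻¹(𝕋³)`, its pairings with smooth
mean-zero test fields tend to `0`, by the duality of `Ḣ⁻¹` with `Ḣ¹` on mean-zero fields:

* `Torus.mFourierCoeff_complexify_zero_of_hasZeroMean` — the zero mode of a mean-zero field
  vanishes;
* `Torus.ofReal_abs_integral_inner_le_eHomSobolevSeminorm_mul` — for `f, φ ∈ L²(𝕋ᵈ; ℝᵈ)` with
  `∫ φ = 0`,
  `|∫⟪f, φ⟫| ≤ ‖f‖_{Ḣ⁻¹} · (Σₖ |k|² ‖φ̂(k)‖²)^{1/2}` (Parseval in polarised form,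
  `Torus.hasSum_re_inner_mFourierCoeff_complexify`, and Cauchy–Schwarz on `ℤᵈ` with the weights
  `|k|^{∓1}`; the zero mode drops out), stated in `ℝ≥0∞` with the spectral seminorm
  `Torus.eHomSobolevSeminorm (-1)`.

## References

* H. Bahouri, J.-Y. Chemin, R. Danchin, *Fourier Analysis and Nonlinear PDEs* (2011), §1.4
  (duality `Ḣ^{-s} = (Ḣ^s)'`), adapted to `𝕋ᵈ`. [folklore]
* L. Grafakos, *Classical Fourier Analysis*, 3rd ed. (2014), Prop. 3.2.7 (Parseval). [folklore]
* M. P. Coiculescu, S. Palasek, Invent. Math. 244 (2025) = arXiv:2503.14699, §5.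
  [`CoiculescuPalasek2025`]
-/

noncomputable section

open MeasureTheory Set Filter Topology Function UnitAddTorus Complex
open scoped ComplexConjugate ENNReal NNReal InnerProductSpace

namespace Literature.Analysis.FunctionSpaces

namespace Torus

variable {d : Type*} [Fintype d]

/-- **The zero mode of a mean-zero field vanishes**: `𝓕(complexify ∘ φ)(0) = 0` if `∫ φ = 0`
(`φ` integrable). [folklore] -/
theorem mFourierCoeff_complexify_zero_of_hasZeroMean {φ : UnitAddTorus d → EuclideanSpace ℝ d}
    (hφ : Integrable φ volume) (hmean : Torus.HasZeroMean φ) :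
    mFourierCoeff (EuclideanSpace.complexify ∘ φ) 0 = 0 := by
  ext i
  rw [mFourierCoeff_complexify_apply hφ 0 i, mFourierCoeff_zero_eq_integral]
  have h1 : ∫ x, (φ x i : ℂ) = ((∫ x, φ x i : ℝ) : ℂ) := integral_complex_ofReal
  have h2 : ∫ x, φ x i = (∫ x, φ x) i := (eval_integral_piLp (fun j => hφ.eval_piLp j) i).symm
  rw [h1, h2]
  have h0 : ∫ x, φ x = 0 := hmean
  simp [h0]

/-- **`Ḣ⁻¹ – Ḣ¹` duality for pairings of real vector fields on `𝕋ᵈ`.** For `f, φ ∈ L²(𝕋ᵈ; ℝᵈ)`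
with `∫ φ = 0`,
`|∫ ⟪f, φ⟫| ≤ ‖f‖_{Ḣ⁻¹(𝕋ᵈ)} · (Σₖ |k|² ‖𝓕(complexify ∘ φ)(k)‖²)^{1/2}` in `ℝ≥0∞`: by Parseval
`∫⟪f,φ⟫ = Σₖ Re⟪f̂(k), φ̂(k)⟫`, the zero mode vanishes (`φ̂(0) = 0`), and Cauchy–Schwarz with the
weights `|k|⁻¹`, `|k|` (Bahouri–Chemin–Danchin, §1.4, on `𝕋ᵈ`). [folklore] -/
theorem ofReal_abs_integral_inner_le_eHomSobolevSeminorm_mul {f φ : UnitAddTorus d → EuclideanSpace ℝ d}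
    (hf : MemLp f 2 volume) (hφ : MemLp φ 2 volume) (hmean : Torus.HasZeroMean φ) :
    ENNReal.ofReal |∫ x, ⟪f x, φ x⟫_ℝ| ≤
      Torus.eHomSobolevSeminorm (-1) (EuclideanSpace.complexify ∘ f) *
        (∑' k : d → ℤ, ENNReal.ofReal (freqNormSq k) *
          ‖mFourierCoeff (EuclideanSpace.complexify ∘ φ) k‖ₑ ^ 2) ^ (1 / 2 : ℝ) := by
  classical
  set F : (d → ℤ) → EuclideanSpace ℂ d := fun k => mFourierCoeff (EuclideanSpace.complexify ∘ f) k with hF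
  set Φ : (d → ℤ) → EuclideanSpace ℂ d := fun k => mFourierCoeff (EuclideanSpace.complexify ∘ φ) k with hΦ
  have hΦ0 : Φ 0 = 0 := mFourierCoeff_complexify_zero_of_hasZeroMean (hφ.integrable one_le_two) hmean
  -- Parseval, polarised
  have hP := hasSum_re_inner_mFourierCoeff_complexify hf hφ
  -- the terms are dominated by `‖F k‖ ‖Φ k‖`, a summable family (Cauchy–Schwarz from Parseval)
  have hsumF : Summable fun k => ‖F k‖ ^ 2 := (hasSum_sq_norm_mFourierCoeff_complexify hf).summable
  have hsumΦ : Summable fun k => ‖Φ k‖ ^ 2 := (hasSum_sq_norm_mFourierCoeff_complexify hφ).summable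
  have hprod : Summable fun k => ‖F k‖ * ‖Φ k‖ :=
    Real.summable_mul_of_Lp_Lq_of_nonneg Real.HolderConjugate.two_two
      (fun k => norm_nonneg (F k)) (fun k => norm_nonneg (Φ k))
      (by simpa [Real.rpow_two] using hsumF) (by simpa [Real.rpow_two] using hsumΦ)
  have hterm : ∀ k, |(⟪F k, Φ k⟫_ℂ).re| ≤ ‖F k‖ * ‖Φ k‖ := fun k =>
    (abs_re_le_norm _).trans (norm_inner_le_norm _ _)
  have hnorm : Summable fun k => ‖(⟪F k, Φ k⟫_ℂ).re‖ :=
    hprod.of_nonneg_of_le (fun k => norm_nonneg _) (fun k => by rw [Real.norm_eq_abs]; exact hterm k)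
  have habs : |∫ x, ⟪f x, φ x⟫_ℝ| ≤ ∑' k, ‖F k‖ * ‖Φ k‖ := by
    rw [← hP.tsum_eq, ← Real.norm_eq_abs]
    refine (norm_tsum_le_tsum_norm hnorm).trans ?_
    exact Summable.tsum_le_tsum (fun k => by rw [Real.norm_eq_abs]; exact hterm k) hnorm hprod
  -- pass to `ℝ≥0∞` and split the weights
  set wF : (d → ℤ) → ℝ≥0∞ := fun k =>
    (if k = 0 then 0 else ENNReal.ofReal (freqNormSq k ^ (-1 : ℝ))) ^ (1 / 2 : ℝ) * ‖F k‖ₑ with hwF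
  set wΦ : (d → ℤ) → ℝ≥0∞ := fun k => ENNReal.ofReal (freqNormSq k) ^ (1 / 2 : ℝ) * ‖Φ k‖ₑ with hwΦ
  have hsplit : ∀ k, ENNReal.ofReal (‖F k‖ * ‖Φ k‖) = wF k * wΦ k := by
    intro k
    by_cases hk : k = 0
    · subst hk
      simp [hwF, hwΦ, hΦ0]
    · have hfq : 0 < freqNormSq k := lt_of_lt_of_le one_pos (one_le_freqNormSq_of_ne_zero hk)
      simp only [hwF, hwΦ, if_neg hk]
      rw [ENNReal.ofReal_mul (norm_nonneg _), ← ofReal_norm, ← ofReal_norm]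
      have hw : (ENNReal.ofReal (freqNormSq k ^ (-1 : ℝ))) ^ (1 / 2 : ℝ) *
          ENNReal.ofReal (freqNormSq k) ^ (1 / 2 : ℝ) = 1 := by
        rw [← ENNReal.mul_rpow_of_nonneg _ _ (by norm_num), ← ENNReal.ofReal_mul (Real.rpow_nonneg hfq.le _),
          Real.rpow_neg_one, inv_mul_cancel₀ hfq.ne', ENNReal.ofReal_one, ENNReal.one_rpow]
      calc ENNReal.ofReal ‖F k‖ * ENNReal.ofReal ‖Φ k‖
          = 1 * (ENNReal.ofReal ‖F k‖ * ENNReal.ofReal ‖Φ k‖) := (one_mul _).symm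
        _ = _ := by rw [← hw]; ring
  have hstep1 : ENNReal.ofReal |∫ x, ⟪f x, φ x⟫_ℝ| ≤ ∑' k, wF k * wΦ k := by
    refine (ENNReal.ofReal_le_ofReal habs).trans ?_
    rw [ENNReal.ofReal_tsum_of_nonneg (fun k => mul_nonneg (norm_nonneg _) (norm_nonneg _)) hprod]
    exact le_of_eq (tsum_congr hsplit)
  -- Cauchy–Schwarz on `ℤᵈ` (Hölder for the counting measure)
  have hmeas : ∀ g : (d → ℤ) → ℝ≥0∞, AEMeasurable g (Measure.count : Measure (d → ℤ)) := fun g =>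
    (measurable_of_countable g).aemeasurable
  have hH := ENNReal.lintegral_mul_le_Lp_mul_Lq (Measure.count : Measure (d → ℤ))
    Real.HolderConjugate.two_two (hmeas wF) (hmeas wΦ)
  simp only [lintegral_count, Pi.mul_apply] at hH
  refine hstep1.trans (hH.trans (le_of_eq ?_))
  -- identify the two factors
  have h1 : (∑' k, wF k ^ (2 : ℝ)) ^ (1 / (2 : ℝ)) =
      Torus.eHomSobolevSeminorm (-1) (EuclideanSpace.complexify ∘ f) := by
    unfold Torus.eHomSobolevSeminorm
    congr 1
    refine tsum_congr fun k => ?_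
    simp only [hwF, hF]
    rw [ENNReal.mul_rpow_of_nonneg _ _ (by norm_num), ← ENNReal.rpow_mul]
    norm_num
  have h2 : (∑' k, wΦ k ^ (2 : ℝ)) ^ (1 / (2 : ℝ)) =
      (∑' k : d → ℤ, ENNReal.ofReal (freqNormSq k) *
        ‖mFourierCoeff (EuclideanSpace.complexify ∘ φ) k‖ₑ ^ 2) ^ (1 / 2 : ℝ) := by
    congr 1
    refine tsum_congr fun k => ?_
    simp only [hwΦ, hΦ]
    rw [ENNReal.mul_rpow_of_nonneg _ _ (by norm_num), ← ENNReal.rpow_mul]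
    norm_num
  rw [h1, h2]

end Torus

end Literature.Analysis.FunctionSpaces
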